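import Mathlib.Analysis.InnerProductSpace.PiL2
import Mathlib.Analysis.Normed.Module.FiniteDimension
import Mathlib.LinearAlgebra.Isomorphisms

/-!
# Equal Gram matrices give isometric configurations; uniqueness of the regular simplex codes

Framing: lottery ticket; floor = certified bounds/negative ranges. Venture `PackingBounds` (cell
`pub-packcert`, seat `pub-packcert-energy`) — uniqueness infrastructure for the attained side.

* `exists_linearIsometryEquiv_of_inner_eq`: two finite families `v w : ι → E` in a finite-dimensional real
  inner product space with the same Gram matrix (`⟪v i, v j⟫ = ⟪w i, w j⟫`) differ by a linear isometry of `E`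
  (`Ψ (v i) = w i`). Proof: `a ↦ Σ aᵢ vᵢ` and `a ↦ Σ aᵢ wᵢ` have the same kernel, so `Σ aᵢ vᵢ ↦ Σ aᵢ wᵢ` is a
  well-defined isometry `span v → E` (`Submodule.liftQ`, `LinearMap.quotKerEquivRange`,
  `LinearMap.isometryOfInner`), extended to `E` by `LinearIsometry.extend`.
* `isometric_of_inner_const`: two `N`-point configurations with a common constant off-diagonal inner product
  are isometric; `inner_eq_of_le` / `isometric_of_simplex_code`: `N` unit vectors with pairwise inner products
  `≤ -1/(N-1)` have all inner products `= -1/(N-1)`, hence **the regular simplex is the unique optimal `N`-point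
  code (`N ≤ n + 1`) up to isometry** (Cohn–Kumar 2007, Table 1: the simplex rows).

## References
* H. Cohn, A. Kumar, J. Amer. Math. Soc. 20 (2007) 99–148, Table 1. [`CohnKumar2006`]
-/

noncomputable section

namespace Summit.Ventures.PackingBounds.Config

open Finset Module

section gram

variable {ι : Type*} [Fintype ι] {E : Type*} [NormedAddCommGroup E] [InnerProductSpace ℝ E]
  [FiniteDimensional ℝ E]

/-- **Equal Gram matrices ⇒ isometric families.** [folklore] -/
theorem exists_linearIsometryEquiv_of_inner_eq (v w : ι → E)
    (h : ∀ i j, inner ℝ (v i) (v j) = inner ℝ (w i) (w j)) :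
    ∃ Ψ : E ≃ₗᵢ[ℝ] E, ∀ i, Ψ (v i) = w i := by
  classical
  let A : (ι → ℝ) →ₗ[ℝ] E :=
    { toFun := fun a => ∑ i, a i • v i
      map_add' := fun a b => by simp [add_smul, Finset.sum_add_distrib]
      map_smul' := fun r a => by simp [Finset.smul_sum, smul_smul] }
  let B : (ι → ℝ) →ₗ[ℝ] E :=
    { toFun := fun a => ∑ i, a i • w i
      map_add' := fun a b => by simp [add_smul, Finset.sum_add_distrib]
      map_smul' := fun r a => by simp [Finset.smul_sum, smul_smul] }
  have hA : ∀ a, A a = ∑ i, a i • v i := fun a => rfl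
  have hB : ∀ a, B a = ∑ i, a i • w i := fun a => rfl
  -- the two combination maps have the same Gram form
  have hAB : ∀ a b, inner ℝ (A a) (A b) = inner ℝ (B a) (B b) := by
    intro a b
    rw [hA, hA, hB, hB, sum_inner, sum_inner]
    refine Finset.sum_congr rfl fun i _ => ?_
    rw [inner_sum, inner_sum]
    refine Finset.sum_congr rfl fun j _ => ?_
    rw [real_inner_smul_left, real_inner_smul_right, real_inner_smul_left, real_inner_smul_right, h i j]
  have hker : LinearMap.ker A ≤ LinearMap.ker B := by
    intro a ha
    rw [LinearMap.mem_ker] at ha ⊢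
    have h0 := hAB a a
    rw [ha, inner_zero_left] at h0
    exact inner_self_eq_zero.mp h0.symm
  -- the well-defined map `Σ aᵢ vᵢ ↦ Σ aᵢ wᵢ` on `range A`
  let g : ((ι → ℝ) ⧸ LinearMap.ker A) →ₗ[ℝ] E := (LinearMap.ker A).liftQ B hker
  let e := A.quotKerEquivRange
  let L₀ : LinearMap.range A →ₗ[ℝ] E := g ∘ₗ e.symm.toLinearMap
  have hL₀ : ∀ a, L₀ ⟨A a, LinearMap.mem_range_self A a⟩ = B a := by
    intro a
    have he : e.symm ⟨A a, LinearMap.mem_range_self A a⟩ = Submodule.Quotient.mk a := by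
      rw [LinearEquiv.symm_apply_eq]
      exact Subtype.ext (LinearMap.quotKerEquivRange_apply_mk A a).symm
    show g (e.symm ⟨A a, LinearMap.mem_range_self A a⟩) = B a
    rw [he]
    exact Submodule.liftQ_apply _ _ a
  have hinner : ∀ x y : LinearMap.range A, inner ℝ (L₀ x) (L₀ y) = inner ℝ (x : E) y := by
    rintro ⟨_, a, rfl⟩ ⟨_, b, rfl⟩
    rw [hL₀ a, hL₀ b]
    exact (hAB a b).symm
  let L₁ : LinearMap.range A →ₗᵢ[ℝ] E := L₀.isometryOfInner hinner
  let L : E →ₗᵢ[ℝ] E := L₁.extend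
  refine ⟨L.toLinearIsometryEquiv rfl, fun i => ?_⟩
  have hvi : A (Pi.single i 1) = v i := by
    rw [hA]; simp [Pi.single_apply]
  have hwi : B (Pi.single i 1) = w i := by
    rw [hB]; simp [Pi.single_apply]
  have hi : v i ∈ LinearMap.range A := ⟨Pi.single i 1, hvi⟩
  rw [LinearIsometry.toLinearIsometryEquiv_apply]
  have h1 : L (v i) = L₁ ⟨v i, hi⟩ := L₁.extend_apply ⟨v i, hi⟩
  rw [h1]
  show L₀ ⟨v i, hi⟩ = w i
  have h2 : (⟨v i, hi⟩ : LinearMap.range A) = ⟨A (Pi.single i 1), LinearMap.mem_range_self A _⟩ :=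
    Subtype.ext hvi.symm
  rw [h2, hL₀, hwi]

end gram

/-! ### Configurations with a constant inner product: uniqueness of the regular simplex -/

/-- **Two `N`-point configurations of unit vectors with the same constant off-diagonal inner product are
isometric.** [folklore] -/
theorem isometric_of_inner_const {n : ℕ} (C C' : Finset (EuclideanSpace ℝ (Fin n))) (c : ℝ)
    (h1 : ∀ x ∈ C, ‖x‖ = 1) (hc : ∀ x ∈ C, ∀ y ∈ C, x ≠ y → inner ℝ x y = c)
    (h1' : ∀ x ∈ C', ‖x‖ = 1) (hc' : ∀ x ∈ C', ∀ y ∈ C', x ≠ y → inner ℝ x y = c)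
    (hcard : C.card = C'.card) :
    ∃ Ψ : EuclideanSpace ℝ (Fin n) ≃ₗᵢ[ℝ] EuclideanSpace ℝ (Fin n), C' = C.image Ψ := by
  classical
  -- enumerate both configurations by `Fin C.card`
  let e : Fin C.card ≃ C := C.equivFin.symm
  let e' : Fin C.card ≃ C' := (hcard ▸ C'.equivFin).symm
  let v : Fin C.card → EuclideanSpace ℝ (Fin n) := fun i => (e i : EuclideanSpace ℝ (Fin n))
  let w : Fin C.card → EuclideanSpace ℝ (Fin n) := fun i => (e' i : EuclideanSpace ℝ (Fin n))
  have hgram : ∀ i j, inner ℝ (v i) (v j) = inner ℝ (w i) (w j) := by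
    intro i j
    by_cases hij : i = j
    · subst hij
      rw [real_inner_self_eq_norm_sq, real_inner_self_eq_norm_sq, h1 _ (e i).2, h1' _ (e' i).2]
    · have hv : (e i : EuclideanSpace ℝ (Fin n)) ≠ e j := fun h => hij (e.injective (Subtype.ext h))
      have hw : (e' i : EuclideanSpace ℝ (Fin n)) ≠ e' j := fun h => hij (e'.injective (Subtype.ext h))
      rw [hc _ (e i).2 _ (e j).2 hv, hc' _ (e' i).2 _ (e' j).2 hw]
  obtain ⟨Ψ, hΨ⟩ := exists_linearIsometryEquiv_of_inner_eq v w hgram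
  refine ⟨Ψ, ?_⟩
  ext y
  simp only [Finset.mem_image]
  constructor
  · intro hy
    refine ⟨(e (e'.symm ⟨y, hy⟩) : EuclideanSpace ℝ (Fin n)), (e _).2, ?_⟩
    have := hΨ (e'.symm ⟨y, hy⟩)
    simp only [v, w, Equiv.apply_symm_apply] at this
    exact this
  · rintro ⟨x, hx, rfl⟩
    have := hΨ (e.symm ⟨x, hx⟩)
    simp only [v, w, Equiv.apply_symm_apply] at this
    rw [this]
    exact (e' _).2

/-- **Below the simplex bound everything is tight**: `N` unit vectors with pairwise inner products
`≤ -1/(N-1)` have all pairwise inner products equal to `-1/(N-1)` (since `Σ_{x ≠ y} ⟪x,y⟫ = ‖Σ x‖² - N ≥ -N`).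
[folklore] -/
theorem inner_eq_of_le {n : ℕ} (C : Finset (EuclideanSpace ℝ (Fin n))) (h1 : ∀ x ∈ C, ‖x‖ = 1)
    (hle : ∀ x ∈ C, ∀ y ∈ C, x ≠ y → inner ℝ x y ≤ -1 / ((C.card : ℝ) - 1)) :
    ∀ x ∈ C, ∀ y ∈ C, x ≠ y → inner ℝ x y = -1 / ((C.card : ℝ) - 1) := by
  classical
  set c : ℝ := -1 / ((C.card : ℝ) - 1) with hcdef
  -- `Σ_{x ≠ y} (⟪x,y⟫ - c) ≥ 0` while every term is `≤ 0`
  have hsum : ∑ x ∈ C, ∑ y ∈ C.erase x, inner ℝ x y = ‖∑ x ∈ C, x‖ ^ 2 - C.card := by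
    have hnorm : ‖∑ x ∈ C, x‖ ^ 2 = ∑ x ∈ C, ∑ y ∈ C, inner ℝ x y := by
      rw [← real_inner_self_eq_norm_sq, sum_inner]
      exact Finset.sum_congr rfl fun x _ => inner_sum _ _ _
    have hdiag : ∀ x ∈ C, ∑ y ∈ C.erase x, inner ℝ x y = ∑ y ∈ C, inner ℝ x y - 1 := by
      intro x hx
      rw [← Finset.sum_erase_add _ _ hx, real_inner_self_eq_norm_sq, h1 x hx]; ring
    rw [Finset.sum_congr rfl hdiag, Finset.sum_sub_distrib, hnorm]
    simp
  have hterm : ∀ x ∈ C, ∀ y ∈ C.erase x, inner ℝ x y - c ≤ 0 := fun x hx y hy =>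
    sub_nonpos.mpr (hle x hx y (Finset.mem_of_mem_erase hy) (Finset.ne_of_mem_erase hy).symm)
  have htot : 0 ≤ ∑ x ∈ C, ∑ y ∈ C.erase x, (inner ℝ x y - c) := by
    rcases Nat.lt_or_ge 1 C.card with h2 | hle1
    · have hN : (1 : ℝ) < C.card := by exact_mod_cast h2
      have hpos : 0 < C.card := by omega
      have hcount : ∑ x ∈ C, ∑ y ∈ C.erase x, c = (C.card : ℝ) * ((C.card : ℝ) - 1) * c := by
        rw [Finset.sum_congr rfl fun x hx => by rw [Finset.sum_const, Finset.card_erase_of_mem hx]]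
        rw [Finset.sum_const, nsmul_eq_mul, nsmul_eq_mul, Nat.cast_sub hpos]
        push_cast; ring
      have hc1 : (C.card : ℝ) * ((C.card : ℝ) - 1) * c = -C.card := by
        have hne : (C.card : ℝ) - 1 ≠ 0 := by linarith
        have h' : ((C.card : ℝ) - 1) * c = -1 := by rw [hcdef]; field_simp
        calc (C.card : ℝ) * ((C.card : ℝ) - 1) * c = (C.card : ℝ) * (((C.card : ℝ) - 1) * c) := by ring
          _ = -C.card := by rw [h']; ring
      simp only [Finset.sum_sub_distrib]
      rw [hsum, hcount, hc1]
      nlinarith [norm_nonneg (∑ x ∈ C, x)]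
    · -- at most one point: the inner sums are empty
      have hempty : ∀ x ∈ C, C.erase x = ∅ := fun x hx =>
        Finset.card_eq_zero.mp (by rw [Finset.card_erase_of_mem hx]; omega)
      rw [Finset.sum_congr rfl fun x hx => by rw [hempty x hx, Finset.sum_empty]]
      simp
  intro x hx y hy hxy
  have hyx : y ∈ C.erase x := Finset.mem_erase.mpr ⟨hxy.symm, hy⟩
  have hall := (Finset.sum_eq_zero_iff_of_nonpos fun x hx =>
    Finset.sum_nonpos fun y hy => hterm x hx y hy).mp (le_antisymm
      (Finset.sum_nonpos fun x hx => Finset.sum_nonpos fun y hy => hterm x hx y hy) htot) x hx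
  have := (Finset.sum_eq_zero_iff_of_nonpos fun y hy => hterm x hx y hy).mp hall y hyx
  linarith

/-- **Uniqueness of the optimal simplex codes** (Cohn–Kumar 2007, Table 1, regular simplices): any two `N`-point
configurations of unit vectors of `ℝⁿ` with pairwise inner products `≤ -1/(N-1)` (e.g. two optimal `N`-point
codes with `N ≤ n + 1`, or two ground states of the simplex energy) are isometric.
[cite: CohnKumar2006, Table 1] -/
theorem isometric_of_simplex_code {n : ℕ} (C C' : Finset (EuclideanSpace ℝ (Fin n)))
    (h1 : ∀ x ∈ C, ‖x‖ = 1) (hle : ∀ x ∈ C, ∀ y ∈ C, x ≠ y → inner ℝ x y ≤ -1 / ((C.card : ℝ) - 1))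
    (h1' : ∀ x ∈ C', ‖x‖ = 1) (hle' : ∀ x ∈ C', ∀ y ∈ C', x ≠ y → inner ℝ x y ≤ -1 / ((C'.card : ℝ) - 1))
    (hcard : C.card = C'.card) :
    ∃ Ψ : EuclideanSpace ℝ (Fin n) ≃ₗᵢ[ℝ] EuclideanSpace ℝ (Fin n), C' = C.image Ψ := by
  have hc := inner_eq_of_le C h1 hle
  have hc' := inner_eq_of_le C' h1' hle'
  rw [← hcard] at hc'
  exact isometric_of_inner_const C C' _ h1 hc h1' hc' hcard

end Summit.Ventures.PackingBounds.Config

end
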